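import Summits.Ventures.PercRepro.RankLevelSetBiIndepPerElem

/-! # RankLevelSetBiIndepSpanUpset — THE DENSITY-MONOTONICITY (UPSET) AND THE SPAN-INJECTION (HH) FORMS OF THE
BI-INDEPENDENT FAMILY, AND THE BRIDGE (UPSET)(M ∖ y) ⟹ (★★)(M; y) (night-1 g25; dossier §37)

For a finite matroid `A` with bi-independent family `D_k = biIndep A k` and profile `D_k = #D_k`:

* `SpanUpClosed A 𝒰` — a family of sets closed under «`Y` is independent and spans a member» (`X ∈ 𝒰`, `Y` independent,
  `X ⊆ cl Y` give `Y ∈ 𝒰`); the families `{X independent : cl X ∈ 𝒰₀}` for an UP-SET `𝒰₀` of flats are the examples,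
  the modular cuts `{X : y ∈ cl_M X}` of an extension among them.
* `BiIndepUpsetMono A` ((UPSET), a `Prop`, NOT asserted): for every span-up-closed `𝒰` and `a ≤ b ≤ #E`,
  `#{X ∈ D_a : X ∈ 𝒰}·D_b ≤ #{X ∈ D_b : X ∈ 𝒰}·D_a` — the density of `𝒰` in the levels is nondecreasing. Equivalent
  (paper, dossier §37) to the normalised matching property of the lattice of flats weighted by
  `β(G) = #{bases of G with independent complement}`; census-clean on every matroid with ≤ 9 elements
  (193,804 consecutive-level instances at n = 9, kit j306035, 0 failures). **FALSE IN GENERAL** (night-1 g25,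
  dossier §37.9): on the theta graph `Θ(1,3,3,4)` (two vertices joined by paths of lengths 1, 3, 3, 4; 11 edges,
  rank 8, bi-forest profile 69 / 240 / 399 / 399 / 240 / 69) the span-up-closed family `{S : y ∈ cl S}` of the direct
  edge `y` has density `11/23` at level 3 and `19/40` at level 4, and the weighted flat NMP flow between levels 3 and 4
  is 16,506 of 16,560. So `BiIndepUpsetMono` holds for no theta graph of this kind, and the bridge below cannot be
  used unconditionally; the hypothesis survives only as a property of particular matroids.
* `BiIndepSpanHall A` ((HH), a `Prop`, NOT asserted): for `2r ≤ #E` an injection `D_r ↪ D_{#E−r}`, `X ↦ φ X`, with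
  `X ⊆ cl (φ X)` (an injection BY SPAN; the plain inclusion version is false at 7 elements). Census-clean on every
  matroid with ≤ 9 elements (192,417 instances at n = 9, kit j306023, 0 Hall failures), on random matroids with
  ≤ 12 elements and on the theta graphs that refute `BiIndepUpsetMono` (night-1 g25, dossier §37.9 (e)) — the one
  strengthening of (★★) of this file still standing.
* **`biIndepPerElem_of_upsetMono`**: if every deletion `M ＼ {y}` satisfies (UPSET) then `M` satisfies (★★) — the
  modular cut of `y` is span-up-closed, and (★★)_j(M; y) is the comparison of its density at the complementary levels
  `j` and `#E − 1 − j` of `M ＼ {y}` (the counting identities `ncard_notMem_eq_compl_filter`,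
  `ncard_mem_eq_filter_insert`, `ncard_filter_compl_eq`).
* **`upsetMono_pair_of_spanHall`** and **`biIndepPerElem_of_spanHall`**: (HH) gives the complementary-level instance of
  (UPSET), hence (★★). Chain: (WNMP) ⟺ (UPSET) ⟹ (HH) ⟹ (★★) ⟹ `BiIndepMono` ⟹ the global level-wise theorems.
Every declaration has a docstring; imports: the cell's own modules and Mathlib only. Axioms: standard. -/

namespace PercRepro

open Set Matroid

section forms

variable {α : Type} (A : Matroid α)

/-- **SPAN-UP-CLOSED**: a family of sets closed under «an independent set spanning a member is a member». -/
def SpanUpClosed (𝒰 : Set (Set α)) : Prop :=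
  ∀ X Y : Set α, X ∈ 𝒰 → A.Indep Y → X ⊆ A.closure Y → Y ∈ 𝒰

/-- **(UPSET) — DENSITY MONOTONICITY** (a `Prop`, NOT asserted, and FALSE for some matroids — the theta graph
`Θ(1,3,3,4)` at its direct edge, dossier §37.9): for every span-up-closed family `𝒰` and all levels
`a ≤ b ≤ #E`, `#{X ∈ D_a : X ∈ 𝒰}·D_b ≤ #{X ∈ D_b : X ∈ 𝒰}·D_a`. -/
def BiIndepUpsetMono : Prop :=
  ∀ 𝒰 : Set (Set α), SpanUpClosed A 𝒰 → ∀ a b : ℕ, a ≤ b → b ≤ A.E.ncard →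
    {X ∈ biIndep A a | X ∈ 𝒰}.ncard * biIndepCount A b ≤ {X ∈ biIndep A b | X ∈ 𝒰}.ncard * biIndepCount A a

/-- **(HH) — THE SPAN-INJECTION FORM** (a `Prop`, NOT asserted): for `2r ≤ #E` an injection `φ : D_r → D_{#E − r}`
with `X ⊆ cl (φ X)`. -/
def BiIndepSpanHall : Prop :=
  ∀ r : ℕ, 2 * r ≤ A.E.ncard → ∃ φ : Set α → Set α, Set.InjOn φ (biIndep A r) ∧
    ∀ X ∈ biIndep A r, φ X ∈ biIndep A (A.E.ncard - r) ∧ X ⊆ A.closure (φ X)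

variable [A.Finite]

/-- **(HH) gives the complementary-level instance of (UPSET)**: for a span-up-closed `𝒰` and `2r ≤ #E`,
`#{X ∈ D_r : X ∈ 𝒰} ≤ #{Y ∈ D_{#E − r} : Y ∈ 𝒰}` (the injection `φ` maps members to members). -/
theorem upsetMono_pair_of_spanHall (h : BiIndepSpanHall A) {𝒰 : Set (Set α)} (h𝒰 : SpanUpClosed A 𝒰)
    {r : ℕ} (hr : 2 * r ≤ A.E.ncard) :
    {X ∈ biIndep A r | X ∈ 𝒰}.ncard ≤ {Y ∈ biIndep A (A.E.ncard - r) | Y ∈ 𝒰}.ncard := by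
  obtain ⟨φ, hinj, hφ⟩ := h r hr
  refine Set.ncard_le_ncard_of_injOn φ ?_ (hinj.mono (fun X hX => hX.1))
    ((biIndep_finite A _).subset (fun Y hY => hY.1))
  rintro X ⟨hX, hXU⟩
  obtain ⟨hφX, hspan⟩ := hφ X hX
  exact ⟨hφX, h𝒰 X (φ X) hXU hφX.2.2.1 hspan⟩

end forms

section bridge

variable {α : Type} (M : Matroid α)

/-- The modular cut of `y` in the deletion `A = M ＼ {y}`: the `A`-independent sets `X` with `X ∪ {y}` dependent
in `M` (equivalently `y ∈ cl_M X`). -/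
def yCut (y : α) : Set (Set α) := {X | (M ＼ {y}).Indep X ∧ ¬ M.Indep (insert y X)}

/-- **The modular cut of `y` is span-up-closed in `M ＼ {y}`**. -/
lemma spanUpClosed_yCut (y : α) : SpanUpClosed (M ＼ {y}) (yCut M y) := by
  rintro X Y ⟨hXA, hXdep⟩ hYA hXY
  refine ⟨hYA, fun hYind => hXdep ?_⟩
  have hYE : Y ⊆ (M ＼ {y}).E := hYA.subset_ground
  have hyY : y ∉ Y := fun hyY => (hYE hyY).2 rfl
  have hY : M.Indep Y := hYA.of_delete
  have hX : M.Indep X := hXA.of_delete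
  have hyX : y ∉ X := fun hyX => (hXA.subset_ground hyX).2 rfl
  -- `y ∉ cl_M Y`
  have hycl : y ∉ M.closure Y := ((hY.insert_indep_iff_of_notMem hyY).mp hYind).2
  -- `X ⊆ cl_M Y` (the closure in the deletion is the closure in `M` minus `y`)
  have hXcl : X ⊆ M.closure Y := by
    rw [delete_closure_eq_of_disjoint M (Set.disjoint_singleton_right.mpr hyY)] at hXY
    exact hXY.trans Set.sdiff_subset
  have hclX : M.closure X ⊆ M.closure Y :=
    (M.closure_subset_closure hXcl).trans (by rw [M.closure_closure])
  have hyE : y ∈ M.E := hYind.subset_ground (Set.mem_insert y Y)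
  exact (hX.insert_indep_iff_of_notMem hyX).mpr ⟨hyE, fun hy => hycl (hclX hy)⟩

/-- **(i)** The bi-independent `j`-sets of `M` avoiding `y` are the bi-independent `j`-sets `P` of `A = M ＼ {y}`
with `(E ∖ {y} ∖ P) ∪ {y}` independent in `M`. -/
lemma biIndep_notMem_eq {y : α} (hy : y ∈ M.E) (j : ℕ) :
    {Z ∈ biIndep M j | y ∉ Z} = {P ∈ biIndep (M ＼ {y}) j | M.Indep (insert y ((M.E \ {y}) \ P))} := by
  ext Z
  simp only [Set.mem_setOf_eq]
  constructor
  · rintro ⟨⟨hZE, hZcard, hZind, hZcind⟩, hyZ⟩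
    have hZA : Z ⊆ M.E \ {y} := fun x hx => ⟨hZE hx, fun hxy => hyZ (hxy ▸ hx)⟩
    have hdisj : Disjoint Z {y} := Set.disjoint_singleton_right.mpr hyZ
    have hcompl : insert y ((M.E \ {y}) \ Z) = M.E \ Z := by
      ext x
      simp only [Set.mem_insert_iff, Set.mem_sdiff, Set.mem_singleton_iff]
      constructor
      · rintro (rfl | ⟨⟨hxE, -⟩, hxZ⟩)
        · exact ⟨hy, hyZ⟩
        · exact ⟨hxE, hxZ⟩
      · rintro ⟨hxE, hxZ⟩
        by_cases hxy : x = y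
        · exact Or.inl hxy
        · exact Or.inr ⟨⟨hxE, hxy⟩, hxZ⟩
    refine ⟨⟨by rw [delete_ground]; exact hZA, hZcard, delete_indep_iff.mpr ⟨hZind, hdisj⟩, ?_⟩, ?_⟩
    · rw [delete_ground, delete_indep_iff]
      refine ⟨hZcind.subset ?_, Set.disjoint_sdiff_left.mono_left Set.sdiff_subset⟩
      exact Set.sdiff_subset_sdiff_left Set.sdiff_subset
    · rw [hcompl]; exact hZcind
  · rintro ⟨⟨hPE, hPcard, hPind, hPcind⟩, hins⟩
    rw [delete_ground] at hPE hPcind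
    have hyP : y ∉ Z := fun hyP => (hPE hyP).2 rfl
    have hcompl : insert y ((M.E \ {y}) \ Z) = M.E \ Z := by
      ext x
      simp only [Set.mem_insert_iff, Set.mem_sdiff, Set.mem_singleton_iff]
      constructor
      · rintro (rfl | ⟨⟨hxE, -⟩, hxZ⟩)
        · exact ⟨hy, hyP⟩
        · exact ⟨hxE, hxZ⟩
      · rintro ⟨hxE, hxZ⟩
        by_cases hxy : x = y
        · exact Or.inl hxy
        · exact Or.inr ⟨⟨hxE, hxy⟩, hxZ⟩
    refine ⟨⟨hPE.trans Set.sdiff_subset, hPcard, hPind.of_delete, ?_⟩, hyP⟩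
    rw [← hcompl]; exact hins

variable [M.Finite]

/-- **(ii)** The bi-independent `(j+1)`-sets of `M` through `y` correspond to the bi-independent `j`-sets `P` of
`A = M ＼ {y}` with `P ∪ {y}` independent in `M` (`Q ↦ Q ∖ {y}`). -/
lemma ncard_mem_eq_filter_insert {y : α} (hy : y ∈ M.E) (j : ℕ) :
    {Q ∈ biIndep M (j + 1) | y ∈ Q}.ncard = {P ∈ biIndep (M ＼ {y}) j | M.Indep (insert y P)}.ncard := by
  classical
  have hEfin : M.E.Finite := M.ground_finite
  refine Set.ncard_congr (fun Q _ => Q \ {y}) ?_ ?_ ?_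
  · rintro Q ⟨⟨hQE, hQcard, hQind, hQcind⟩, hyQ⟩
    have hins : insert y (Q \ {y}) = Q := by rw [Set.insert_sdiff_singleton, Set.insert_eq_of_mem hyQ]
    have hcompl : (M.E \ {y}) \ (Q \ {y}) = M.E \ Q := by
      ext x
      simp only [Set.mem_sdiff, Set.mem_singleton_iff, not_and, not_not]
      constructor
      · rintro ⟨⟨hxE, hxy⟩, h⟩
        exact ⟨hxE, fun hxQ => hxy (h hxQ)⟩
      · rintro ⟨hxE, hxQ⟩
        exact ⟨⟨hxE, fun hxy => hxQ (hxy ▸ hyQ)⟩, fun hxQ' => absurd hxQ' hxQ⟩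
    refine ⟨⟨?_, ?_, ?_, ?_⟩, by rw [hins]; exact hQind⟩
    · rw [delete_ground]; exact Set.sdiff_subset_sdiff_left hQE
    · rw [Set.ncard_sdiff_singleton_of_mem hyQ, hQcard]; rfl
    · exact delete_indep_iff.mpr ⟨hQind.subset Set.sdiff_subset, Set.disjoint_sdiff_left⟩
    · rw [delete_ground, delete_indep_iff, hcompl]
      exact ⟨hQcind, Set.disjoint_singleton_right.mpr (fun h => h.2 hyQ)⟩
  · rintro Q Q' ⟨-, hyQ⟩ ⟨-, hyQ'⟩ hQQ'
    have h1 : insert y (Q \ {y}) = insert y (Q' \ {y}) := by rw [hQQ']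
    rwa [Set.insert_sdiff_singleton, Set.insert_sdiff_singleton, Set.insert_eq_of_mem hyQ,
      Set.insert_eq_of_mem hyQ'] at h1
  · rintro P ⟨⟨hPE, hPcard, hPind, hPcind⟩, hins⟩
    rw [delete_ground] at hPE hPcind
    have hyP : y ∉ P := fun hyP => (hPE hyP).2 rfl
    have hPfin : P.Finite := hEfin.subset (fun x hx => (hPE hx).1)
    have hcompl : M.E \ insert y P = (M.E \ {y}) \ P := by
      ext x
      simp only [Set.mem_sdiff, Set.mem_insert_iff, Set.mem_singleton_iff, not_or]
      tauto
    refine ⟨insert y P, ⟨⟨Set.insert_subset hy (hPE.trans Set.sdiff_subset), ?_, hins, ?_⟩,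
      Set.mem_insert y P⟩, ?_⟩
    · rw [Set.ncard_insert_of_notMem hyP hPfin, hPcard]
    · rw [hcompl]; exact hPcind.of_delete
    · rw [Set.insert_sdiff_of_mem _ (Set.mem_singleton y), Set.sdiff_singleton_eq_self hyP]

/-- **(iii)** Complementation in `A = M ＼ {y}` carries «`(A.E ∖ P) ∪ {y}` independent» at level `j` to
«`R ∪ {y}` independent» at level `#A.E − j`. -/
lemma ncard_filter_compl_insert_eq (y : α) {j : ℕ} (hj : j ≤ (M ＼ {y}).E.ncard) :
    {P ∈ biIndep (M ＼ {y}) j | M.Indep (insert y ((M.E \ {y}) \ P))}.ncard =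
      {R ∈ biIndep (M ＼ {y}) ((M ＼ {y}).E.ncard - j) | M.Indep (insert y R)}.ncard := by
  classical
  refine Set.ncard_congr (fun P _ => (M ＼ {y}).E \ P) ?_ ?_ ?_
  · rintro P ⟨hP, hins⟩
    refine ⟨mem_biIndep_compl _ hP, ?_⟩
    rw [delete_ground]; exact hins
  · rintro P P' ⟨hP, -⟩ ⟨hP', -⟩ hPP'
    have h1 : (M ＼ {y}).E \ ((M ＼ {y}).E \ P) = (M ＼ {y}).E \ ((M ＼ {y}).E \ P') := by rw [hPP']
    rwa [Set.sdiff_sdiff_cancel_left hP.1, Set.sdiff_sdiff_cancel_left hP'.1] at h1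
  · rintro R ⟨hR, hins⟩
    refine ⟨(M ＼ {y}).E \ R, ⟨?_, ?_⟩, Set.sdiff_sdiff_cancel_left hR.1⟩
    · have := mem_biIndep_compl _ hR
      rwa [Nat.sub_sub_self hj] at this
    · rw [delete_ground, Set.sdiff_sdiff_cancel_left (by rw [← delete_ground]; exact hR.1)]
      exact hins

/-- **(iv)** At every level of `A = M ＼ {y}`, the sets with `P ∪ {y}` independent and the members of the cut
together make up the level: `#{P : P ∪ y indep} + #{P ∈ yCut} = D_k(A)`. -/
lemma ncard_filter_insert_add_ncard_yCut (y : α) (k : ℕ) :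
    {P ∈ biIndep (M ＼ {y}) k | M.Indep (insert y P)}.ncard +
      {P ∈ biIndep (M ＼ {y}) k | P ∈ yCut M y}.ncard = biIndepCount (M ＼ {y}) k := by
  classical
  have hfin : (biIndep (M ＼ {y}) k).Finite := biIndep_finite _ k
  have hdisj : Disjoint {P ∈ biIndep (M ＼ {y}) k | M.Indep (insert y P)}
      {P ∈ biIndep (M ＼ {y}) k | P ∈ yCut M y} := by
    rw [Set.disjoint_left]
    rintro P ⟨-, hind⟩ ⟨-, -, hdep⟩
    exact hdep hind
  have hunion : {P ∈ biIndep (M ＼ {y}) k | M.Indep (insert y P)} ∪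
      {P ∈ biIndep (M ＼ {y}) k | P ∈ yCut M y} = biIndep (M ＼ {y}) k := by
    ext P
    simp only [Set.mem_union, Set.mem_setOf_eq, yCut]
    constructor
    · rintro (⟨hP, -⟩ | ⟨hP, -⟩) <;> exact hP
    · intro hP
      by_cases hind : M.Indep (insert y P)
      · exact Or.inl ⟨hP, hind⟩
      · exact Or.inr ⟨hP, hP.2.2.1, hind⟩
  have := Set.ncard_union_eq hdisj (hfin.subset (fun P hP => hP.1)) (hfin.subset (fun P hP => hP.1))
  rw [hunion] at this
  exact this.symm

/-- **THE BRIDGE (UPSET)(M ∖ y) ⟹ (★★)(M; y)**: if every single-element deletion of `M` satisfies the density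
monotonicity (UPSET), then `M` satisfies the per-element inequality (★★). -/
theorem biIndepPerElem_of_upsetMono (h : ∀ y ∈ M.E, BiIndepUpsetMono (M ＼ {y})) : BiIndepPerElem M := by
  intro y hy j hj
  have hm : (M ＼ {y}).E.ncard = M.E.ncard - 1 := by
    rw [delete_ground, Set.ncard_sdiff' (Set.singleton_subset_iff.mpr hy) M.ground_finite, Set.ncard_singleton]
  have hjm : j ≤ (M ＼ {y}).E.ncard := by omega
  have hjm' : j ≤ (M ＼ {y}).E.ncard - j := by omega
  -- the left side is the «independent-with-y» count at level `m − j`, the right side at level `j`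
  rw [biIndep_notMem_eq M hy j, ncard_filter_compl_insert_eq M y hjm, ncard_mem_eq_filter_insert M hy j]
  have h1 := ncard_filter_insert_add_ncard_yCut M y ((M ＼ {y}).E.ncard - j)
  have h2 := ncard_filter_insert_add_ncard_yCut M y j
  have hsymm : biIndepCount (M ＼ {y}) ((M ＼ {y}).E.ncard - j) = biIndepCount (M ＼ {y}) j :=
    biIndepCount_compl _ j hjm
  -- the density inequality of the cut at the complementary levels
  have hU := h y hy (yCut M y) (spanUpClosed_yCut M y) j ((M ＼ {y}).E.ncard - j) hjm' (Nat.sub_le _ j)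
  rw [hsymm] at hU h1
  -- `u_j ≤ u_{m−j}`
  have hu : {P ∈ biIndep (M ＼ {y}) j | P ∈ yCut M y}.ncard ≤
      {P ∈ biIndep (M ＼ {y}) ((M ＼ {y}).E.ncard - j) | P ∈ yCut M y}.ncard := by
    rcases Nat.eq_zero_or_pos (biIndepCount (M ＼ {y}) j) with h0 | hpos
    · rw [h0] at h1 h2; omega
    · exact Nat.le_of_mul_le_mul_right hU hpos
  omega

/-- **THE BRIDGE (HH)(M ∖ y) ⟹ (★★)(M; y)**: if every single-element deletion of `M` has the span-injection (HH),
then `M` satisfies (★★). -/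
theorem biIndepPerElem_of_spanHall (h : ∀ y ∈ M.E, BiIndepSpanHall (M ＼ {y})) : BiIndepPerElem M := by
  intro y hy j hj
  have hm : (M ＼ {y}).E.ncard = M.E.ncard - 1 := by
    rw [delete_ground, Set.ncard_sdiff' (Set.singleton_subset_iff.mpr hy) M.ground_finite, Set.ncard_singleton]
  have hjm : j ≤ (M ＼ {y}).E.ncard := by omega
  have hr : 2 * j ≤ (M ＼ {y}).E.ncard := by omega
  rw [biIndep_notMem_eq M hy j, ncard_filter_compl_insert_eq M y hjm, ncard_mem_eq_filter_insert M hy j]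
  have h1 := ncard_filter_insert_add_ncard_yCut M y ((M ＼ {y}).E.ncard - j)
  have h2 := ncard_filter_insert_add_ncard_yCut M y j
  have hsymm : biIndepCount (M ＼ {y}) ((M ＼ {y}).E.ncard - j) = biIndepCount (M ＼ {y}) j :=
    biIndepCount_compl _ j hjm
  have hu := upsetMono_pair_of_spanHall (M ＼ {y}) (h y hy) (spanUpClosed_yCut M y) hr
  rw [hsymm] at h1
  omega

end bridge

end PercRepro
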